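import Summits.BirchSwinnertonDyer.BirchSwinnertonDyer.Theorems.PrintCf2RamifiedOffTYZEvenOmegaRowFourExpand
import HarnessLib

/-!
# Route `PrintCf2`, crux stmt-BirchSwinnertonDyer-20509 `RamifiedOffTYZOfFacts` — THE EVEN Ω-IDENTITY, ROW (iv) (`x_a x_b`), ABSTRACT FOREST FORM
# (cell `bsd-print-cf2`, LEAD of 20509 g14, line `offtyz-v7`, cycle 15; kernel helpers `--supports stmt-BirchSwinnertonDyer-20509`)

Row (iv) of LEAD g13's research statement `EvenOmegaMatrixIdentity` (crux workfile `Cruxes/RamifiedOffTYZOfFacts/Lines/offtyz_v7_EvenOmega.lean`;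
proof `Lines/offtyz_v7_EvenOmegaProof.md` §5, LEAD g14), second half: with the notation of the sibling file `…EvenOmegaRowFourExpand`
(reciprocity law on all of `V`, `Σ_D y = 1`, `Y = setExp(q_y)`, `F = setExp(fwt a y z z)`, `W′ = setExp(fwt a y z 0)`, `E = setExp(q_{y+z})`,
`f_o = fwt a y z 0`, `Β_ev(x,x′) = ((p_y p_{x′}((p_x q_z) ⋆ E)) ⋆ W′)(D)`, `Β_od(x,x′) = ((p_z p_{x′}(q_x ⋆ Y)) ⋆ (f_o ⋆ F))(D)`,
`Tgt(x,x′) = (Σ_D x′)·((p_y q_x) ⋆ F)(D)`):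

  **(iv)**  `Β_ev(x,x′) + Β_ev(x′,x) + Β_od(x,x′) + Β_od(x′,x) = Tgt(x,x′) + Tgt(x′,x)`   for unit vectors `x = e_s`, `x′ = e_t`
  (`row_four_identity`; the `x_a x_b`-coefficient of the even Ω-identity is its value at `(e_a, e_b)`).

* §4 THE CORE (`core_symm_eq_zero`): the one term of the symmetrised difference that does not cancel formally,
  `V_{st} = (p_z p_{e_t} q_{e_s}) ⋆ Y + q_{e_s} ⋆ (p_{e_t} f_o)`, satisfies `V_{st}(T) + V_{ts}(T) = 0` on every EVEN block `T`: both halves equal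
  `(Σ_T z)(κ_s(T) + κ_t(T))` — the doubly pointed one by flatness (`κ_s = κ_t` on an odd sub-block), the singly pointed one by the pair term
  (`pair_term_even`) and the tree's pinned pair identity `κ_s(T) + κ_t(T) = Σ_{X₀} κ_s({s}∪X₀)·Y({t}∪(W₀∖X₀))` (`treeDet_add_treeDet_eq_sum_pinned`).
* §5 the assembly (`row_four_identity`): expansions + cancellations of the sibling file + §4, closed by linear arithmetic over `𝔽₂`.
Pure linear algebra / finite combinatorics over `𝔽₂`; no number theory, no `sorry`.  BSD is not proved by any of this; no class is closed.

References: [cite: Chaiken1982, §2]; [cite: Stanley1999EC2, Cor. 5.1.6]; [cite: Smith2016CongruentDensity, §2.2 case 5(b)];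
[cite: HeathBrown1994SelmerCongruentII, Appendix (Monsky), typescript p. 41 L20–L36]; crux notes `Lines/offtyz_v7_EvenOmegaProof.md` §5.
-/

namespace Summit.BirchSwinnertonDyer.PrintCf2.QFormForest

open Matrix Finset Literature.LinearAlgebra.Matrix Literature.Combinatorics.Enumerative
open Literature.NumberTheory.EllipticCurves.Smith2016

variable {V : Type*} [Fintype V] [LinearOrder V]

section RowFour

variable (a : V → V → ZMod 2) (y z : V → ZMod 2) (hrec : ∀ i j : V, i ≠ j → a i j + a j i = y i * y j)

/-! ## §4. The core: the pinned pair identity kills the last term -/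

include hrec in
/-- **The pair term on an even block**: for blocks `C ∋ s`, `X ∋ t` with `Σ_C y + Σ_X y = 0`:
`κ_s(C)·f_o(X) + κ_t(X)·f_o(C) = (Σ_T z)·κ_s(C)·Y(X)` (both sides vanish when `C`, `X` are even; when both are odd, flatness).
[cite: Smith2016CongruentDensity, §2.2 case 5(b)] [cite: Chaiken1982, §2] -/
theorem pair_term_even {C X : Finset V} (hy : ∑ i ∈ C, y i + ∑ i ∈ X, y i = 0) {s t : V} (hs : s ∈ C) (ht : t ∈ X) :
    treeDet a C s * fwt a y z 0 X + treeDet a X t * fwt a y z 0 C =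
      (∑ i ∈ C, z i + ∑ i ∈ X, z i) * (treeDet a C s * setExp (qwt a y) X) := by
  have hrecC : ∀ i ∈ C, ∀ j ∈ C, i ≠ j → a i j + a j i = y i * y j := fun i _ j _ hij => hrec i j hij
  have hrecX : ∀ i ∈ X, ∀ j ∈ X, i ≠ j → a i j + a j i = y i * y j := fun i _ j _ hij => hrec i j hij
  have hXne : X.Nonempty := ⟨t, ht⟩
  by_cases hyC : ∑ i ∈ C, y i = 1
  · have hyX : ∑ i ∈ X, y i = 1 := by
      have e : ∀ u : ZMod 2, 1 + u = 0 → u = 1 := by decide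
      rw [hyC] at hy; exact e _ hy
    rw [fwt_zero_root_of_odd a y z hrecX hyX ht, fwt_zero_root_of_odd a y z hrecC hyC hs,
      setExp_qwt_eq_sum_mul_qwt a y hXne hrecX, qwt_eq_sum_mul_treeDet_of_odd a y y hrecX hyX ht, hyX, one_mul, one_mul]
    ring
  · have hyC0 : ∑ i ∈ C, y i = 0 := by
      have h01 : ∀ u : ZMod 2, u ≠ 1 → u = 0 := by decide
      exact h01 _ hyC
    have hyX0 : ∑ i ∈ X, y i = 0 := by rw [hyC0, zero_add] at hy; exact hy
    rw [fwt_zero_root_of_even a y z hyX0, fwt_zero_root_of_even a y z hyC0, setExp_qwt_self_eq_zero_of_even a y hrec hXne hyX0]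
    ring

omit [Fintype V] in
/-- Set bookkeeping for the pinned pair: with `W₀ = T ∖ {s,t}` and `X₀ ⊆ W₀`, the complements of `{s} ∪ X₀`, `{t} ∪ (W₀ ∖ X₀)` and
`{s,t} ∪ X₀` inside `T`. [folklore] -/
theorem pair_sdiff_bookkeeping {T X₀ : Finset V} {s t : V} (hs : s ∈ T) (ht : t ∈ T) (hst : s ≠ t) (hX₀ : X₀ ⊆ (T.erase s).erase t) :
    T \ insert s X₀ = insert t (((T.erase s).erase t) \ X₀) ∧ T \ insert t (((T.erase s).erase t) \ X₀) = insert s X₀ ∧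
      T \ insert s (insert t X₀) = ((T.erase s).erase t) \ X₀ ∧ insert s (insert t ((T.erase s).erase t)) = T := by
  have hX : ∀ i ∈ X₀, i ∈ T ∧ i ≠ s ∧ i ≠ t := by
    intro i hi
    have h := hX₀ hi
    simp only [mem_erase] at h
    exact ⟨h.2.2, h.2.1, h.1⟩
  have htX : t ∉ X₀ := fun h => (hX t h).2.2 rfl
  have hsX : s ∉ X₀ := fun h => (hX s h).2.1 rfl
  refine ⟨?_, ?_, ?_, ?_⟩
  · ext i
    simp only [mem_sdiff, mem_insert, mem_erase, not_or]
    by_cases hit : i = t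
    · rw [hit]
      exact ⟨fun _ => Or.inl rfl, fun _ => ⟨ht, fun h => hst h.symm, htX⟩⟩
    · constructor
      · rintro ⟨hiT, his, hiX⟩
        exact Or.inr ⟨⟨hit, his, hiT⟩, hiX⟩
      · rintro (h | ⟨⟨-, his, hiT⟩, hiX⟩)
        · exact absurd h hit
        · exact ⟨hiT, his, hiX⟩
  · ext i
    simp only [mem_sdiff, mem_insert, mem_erase, not_or, not_and, not_not]
    by_cases his : i = s
    · rw [his]
      exact ⟨fun _ => Or.inl rfl, fun _ => ⟨hs, hst, fun h => absurd rfl h.2.1⟩⟩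
    · constructor
      · rintro ⟨hiT, hit, himp⟩
        exact Or.inr (himp ⟨hit, his, hiT⟩)
      · rintro (h | hiX)
        · exact absurd h his
        · obtain ⟨hiT, -, hit⟩ := hX i hiX
          exact ⟨hiT, hit, fun _ => hiX⟩
  · ext i
    simp only [mem_sdiff, mem_insert, mem_erase, not_or]
    constructor
    · rintro ⟨hiT, his, hit, hiX⟩
      exact ⟨⟨hit, his, hiT⟩, hiX⟩
    · rintro ⟨⟨hit, his, hiT⟩, hiX⟩
      exact ⟨hiT, his, hit, hiX⟩
  · rw [insert_erase (mem_erase.mpr ⟨fun h => hst h.symm, ht⟩), insert_erase hs]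

/-- **The two pointed sums of the core term, re-indexed over `W₀ = T ∖ {s,t}`**: for `s ≠ t ∈ T`,
`((p_z p_{e_t} q_{e_s}) ⋆ Y + q_{e_s} ⋆ (p_{e_t} f_o))(T) = Σ_{X₀ ⊆ W₀} (Σ_{C} z) κ_s(C) Y(T∖C) + Σ_{X₀ ⊆ W₀} κ_s({s}∪X₀) f_o(T∖({s}∪X₀))`,
`C = {s,t} ∪ X₀`. [cite: Stanley1999EC2, Cor. 5.1.6] [cite: ChebotarevAgaev2002, §3 Thm. 1] -/
theorem core_term_eq_sum {T : Finset V} {s t : V} (hs : s ∈ T) (ht : t ∈ T) (hst : s ≠ t) :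
    (sconv (spoint z (spoint (Pi.single t 1) (qwt a (Pi.single s 1)))) (setExp (qwt a y)) +
        sconv (qwt a (Pi.single s 1)) (spoint (Pi.single t 1) (fwt a y z 0))) T =
      ∑ X₀ ∈ ((T.erase s).erase t).powerset,
          (∑ i ∈ insert s (insert t X₀), z i) * treeDet a (insert s (insert t X₀)) s * setExp (qwt a y) (T \ insert s (insert t X₀)) +
        ∑ X₀ ∈ ((T.erase s).erase t).powerset, treeDet a (insert s X₀) s * fwt a y z 0 (T \ insert s X₀) := by
  have hts : t ∈ T.erase s := mem_erase.mpr ⟨fun h => hst h.symm, ht⟩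
  rw [Pi.add_apply, sconv_apply, sconv_apply]
  congr 1
  · -- first sum: only `C ∋ s, t` contribute
    have hC : ∀ C ∈ T.powerset, spoint z (spoint (Pi.single t 1) (qwt a (Pi.single s 1))) C * setExp (qwt a y) (T \ C) =
        if s ∈ C then (∑ i ∈ C, z i) * (if t ∈ C then (1 : ZMod 2) else 0) * treeDet a C s * setExp (qwt a y) (T \ C) else 0 := by
      intro C _
      rw [spoint_apply, spoint_apply, qwt_single, sum_pi_single']
      split_ifs <;> ring
    rw [sum_congr rfl hC, ← sum_filter, sum_powerset_filter_mem_eq _ hs]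
    have hB : ∀ B ∈ (T.erase s).powerset, (∑ i ∈ insert s B, z i) * (if t ∈ insert s B then (1 : ZMod 2) else 0) *
        treeDet a (insert s B) s * setExp (qwt a y) (T \ insert s B) =
        if t ∈ B then (∑ i ∈ insert s B, z i) * treeDet a (insert s B) s * setExp (qwt a y) (T \ insert s B) else 0 := by
      intro B _
      have htB : (t ∈ insert s B) ↔ t ∈ B := by
        rw [mem_insert]; exact ⟨fun h => h.resolve_left (fun h' => hst h'.symm), Or.inr⟩
      by_cases htB' : t ∈ B
      · rw [if_pos (htB.mpr htB'), if_pos htB', mul_one]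
      · rw [if_neg (fun h => htB' (htB.mp h)), if_neg htB', mul_zero, zero_mul, zero_mul]
    rw [sum_congr rfl hB, ← sum_filter, sum_powerset_filter_mem_eq _ hts]
  · -- second sum: only `C ∋ s` with `t ∉ C` contribute
    have hC : ∀ C ∈ T.powerset, qwt a (Pi.single s 1) C * spoint (Pi.single t 1) (fwt a y z 0) (T \ C) =
        if s ∈ C then treeDet a C s * ((if t ∈ T \ C then (1 : ZMod 2) else 0) * fwt a y z 0 (T \ C)) else 0 := by
      intro C _
      rw [spoint_apply, qwt_single, sum_pi_single']
      split_ifs <;> ring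
    rw [sum_congr rfl hC, ← sum_filter, sum_powerset_filter_mem_eq _ hs]
    have hB : ∀ B ∈ (T.erase s).powerset, treeDet a (insert s B) s * ((if t ∈ T \ insert s B then (1 : ZMod 2) else 0) *
        fwt a y z 0 (T \ insert s B)) = if ¬ t ∈ B then treeDet a (insert s B) s * fwt a y z 0 (T \ insert s B) else 0 := by
      intro B _
      have htB : (t ∈ T \ insert s B) ↔ ¬ t ∈ B := by
        rw [mem_sdiff, mem_insert, not_or]
        exact ⟨fun h => h.2.2, fun h => ⟨ht, fun h' => hst h'.symm, h⟩⟩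
      by_cases htB' : t ∈ B
      · rw [if_neg (fun h => (htB.mp h) htB'), if_neg (not_not_intro htB'), zero_mul, mul_zero]
      · rw [if_pos (htB.mpr htB'), if_pos htB', one_mul]
    rw [sum_congr rfl hB, ← sum_filter, powerset_filter_not_mem_eq]

include hrec in
/-- **THE CORE CANCELLATION (pinned pair identity).**  For an even block `T` (`Σ_T y = 0`) and vertices `s, t`:
`V_{st}(T) + V_{ts}(T) = 0`, where `V_{st} = (p_z p_{e_t} q_{e_s}) ⋆ Y + q_{e_s} ⋆ (p_{e_t} f_o)` — the `(e_s, e_t)`-value of the only term of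
row (iv) that does not cancel formally.  Both groups of terms equal `(Σ_T z)·(κ_s(T) + κ_t(T))`: the doubly pointed ones because a proper
sub-block facing a non-zero `Y` is odd and then `κ_s = κ_t` (flatness); the singly pointed ones by the pair term (`pair_term_even`) and the tree's
pinned pair identity `κ_s(T) + κ_t(T) = Σ_{X₀} κ_s({s}∪X₀)·Y({t}∪(W₀∖X₀))` (`treeDet_add_treeDet_eq_sum_pinned`).
[cite: Chaiken1982, §2] [cite: Smith2016CongruentDensity, §2.2 case 5(b)] -/
theorem core_symm_eq_zero {T : Finset V} (hyT : ∑ i ∈ T, y i = 0) (s t : V) :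
    (sconv (spoint z (spoint (Pi.single t 1) (qwt a (Pi.single s 1)))) (setExp (qwt a y)) +
        sconv (qwt a (Pi.single s 1)) (spoint (Pi.single t 1) (fwt a y z 0))) T +
      (sconv (spoint z (spoint (Pi.single s 1) (qwt a (Pi.single t 1)))) (setExp (qwt a y)) +
        sconv (qwt a (Pi.single t 1)) (spoint (Pi.single s 1) (fwt a y z 0))) T = 0 := by
  classical
  -- degenerate cases: a vertex outside `T`, or `s = t`
  have hvan : ∀ u v : V, u ∉ T → (sconv (spoint z (spoint (Pi.single v 1) (qwt a (Pi.single u 1)))) (setExp (qwt a y)) +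
      sconv (qwt a (Pi.single u 1)) (spoint (Pi.single v 1) (fwt a y z 0))) T = 0 ∧
      (sconv (spoint z (spoint (Pi.single u 1) (qwt a (Pi.single v 1)))) (setExp (qwt a y)) +
      sconv (qwt a (Pi.single v 1)) (spoint (Pi.single u 1) (fwt a y z 0))) T = 0 := by
    intro u v hu
    refine ⟨?_, ?_⟩
    · rw [Pi.add_apply, sconv_eq_zero_of, sconv_eq_zero_of, add_zero]
      · intro A hA
        have huA : u ∉ A := fun h => hu (hA h)
        rw [qwt_single, if_neg huA, zero_mul]
      · intro A hA
        have huA : u ∉ A := fun h => hu (hA h)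
        rw [spoint_apply, spoint_apply, qwt_single, if_neg huA, mul_zero, mul_zero, zero_mul]
    · rw [Pi.add_apply, sconv_eq_zero_of, sconv_eq_zero_of, add_zero]
      · intro A _
        have huA : u ∉ T \ A := fun h => hu (sdiff_subset h)
        rw [spoint_apply, sum_pi_single', if_neg huA, zero_mul, mul_zero]
      · intro A hA
        have huA : u ∉ A := fun h => hu (hA h)
        rw [spoint_apply, spoint_apply, sum_pi_single', if_neg huA, zero_mul, mul_zero, zero_mul]
  by_cases hs : s ∈ T
  swap
  · obtain ⟨h1, h2⟩ := hvan s t hs; rw [h1, h2, add_zero]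
  by_cases ht : t ∈ T
  swap
  · obtain ⟨h1, h2⟩ := hvan t s ht; rw [h1, h2, zero_add]
  by_cases hst : s = t
  · subst hst; exact CharTwo.add_self_eq_zero _
  -- main case
  set W₀ := (T.erase s).erase t with hW₀
  have hW₀' : (T.erase t).erase s = W₀ := by rw [hW₀, erase_right_comm]
  rw [core_term_eq_sum a y z hs ht hst, core_term_eq_sum a y z ht hs (Ne.symm hst), hW₀']
  -- the doubly pointed sums add up to `(Σ_T z)(κ_s(T) + κ_t(T))`
  have hA : ∑ X₀ ∈ W₀.powerset, (∑ i ∈ insert s (insert t X₀), z i) * treeDet a (insert s (insert t X₀)) s *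
        setExp (qwt a y) (T \ insert s (insert t X₀)) +
      ∑ X₀ ∈ W₀.powerset, (∑ i ∈ insert t (insert s X₀), z i) * treeDet a (insert t (insert s X₀)) t *
        setExp (qwt a y) (T \ insert t (insert s X₀)) =
      (∑ i ∈ T, z i) * (treeDet a T s + treeDet a T t) := by
    rw [← sum_add_distrib]
    have hX : ∀ X₀ ∈ W₀.powerset, (∑ i ∈ insert s (insert t X₀), z i) * treeDet a (insert s (insert t X₀)) s *
          setExp (qwt a y) (T \ insert s (insert t X₀)) +
        (∑ i ∈ insert t (insert s X₀), z i) * treeDet a (insert t (insert s X₀)) t * setExp (qwt a y) (T \ insert t (insert s X₀)) =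
        if X₀ = W₀ then (∑ i ∈ T, z i) * (treeDet a T s + treeDet a T t) else 0 := by
      intro X₀ hX₀
      rw [mem_powerset] at hX₀
      obtain ⟨-, -, h3, h4⟩ := pair_sdiff_bookkeeping hs ht hst hX₀
      rw [insert_comm t s, h3]
      by_cases hXW : X₀ = W₀
      · rw [if_pos hXW, hXW, h4, sdiff_self, bot_eq_empty, setExp_empty]; ring
      rw [if_neg hXW]
      have hne : (W₀ \ X₀).Nonempty := by
        rw [nonempty_iff_ne_empty, Ne, sdiff_eq_empty_iff_subset]
        exact fun h => hXW (subset_antisymm hX₀ h)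
      by_cases hyR : ∑ i ∈ W₀ \ X₀, y i = 0
      · rw [setExp_qwt_self_eq_zero_of_even a y hrec hne hyR]; ring
      · -- the block `{s,t} ∪ X₀` is odd: `κ_s = κ_t`
        have hsplit : ∑ i ∈ T, y i = ∑ i ∈ insert s (insert t X₀), y i + ∑ i ∈ W₀ \ X₀, y i := by
          rw [← h3, ← sum_union disjoint_sdiff, union_sdiff_of_subset]
          exact insert_subset hs (insert_subset ht (hX₀.trans ((erase_subset _ _).trans (erase_subset _ _))))
        have hyC : ∑ i ∈ insert s (insert t X₀), y i = 1 := by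
          have h01 : ∀ u v : ZMod 2, 0 = u + v → v ≠ 0 → u = 1 := by decide
          exact h01 _ _ (hyT ▸ hsplit) hyR
        rw [treeDet_eq_treeDet_of_odd a y (fun i _ j _ hij => hrec i j hij) hyC (mem_insert_self s _)
          (mem_insert_of_mem (mem_insert_self t X₀))]
        exact CharTwo.add_self_eq_zero _
    rw [sum_congr rfl hX, sum_ite_eq' W₀.powerset W₀, if_pos (mem_powerset_self W₀)]
  -- the singly pointed sums add up to the same, by the pair term and the pinned pair identity
  have hB : ∑ X₀ ∈ W₀.powerset, treeDet a (insert s X₀) s * fwt a y z 0 (T \ insert s X₀) +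
      ∑ X₀ ∈ W₀.powerset, treeDet a (insert t X₀) t * fwt a y z 0 (T \ insert t X₀) =
      (∑ i ∈ T, z i) * (treeDet a T s + treeDet a T t) := by
    rw [sum_powerset_eq_sum_powerset_sdiff W₀ (fun X₀ => treeDet a (insert t X₀) t * fwt a y z 0 (T \ insert t X₀)), ← sum_add_distrib]
    have hX : ∀ X₀ ∈ W₀.powerset, treeDet a (insert s X₀) s * fwt a y z 0 (T \ insert s X₀) +
        treeDet a (insert t (W₀ \ X₀)) t * fwt a y z 0 (T \ insert t (W₀ \ X₀)) =
        (∑ i ∈ T, z i) * (treeDet a (insert s X₀) s * setExp (qwt a y) (insert t (W₀ \ X₀))) := by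
      intro X₀ hX₀
      rw [mem_powerset] at hX₀
      obtain ⟨h1, h2, -, -⟩ := pair_sdiff_bookkeeping hs ht hst hX₀
      rw [h1, h2]
      have hdisj : Disjoint (insert s X₀) (insert t (W₀ \ X₀)) := by
        rw [← h1]; exact disjoint_sdiff
      have hunion : insert s X₀ ∪ insert t (W₀ \ X₀) = T := by
        rw [← h1, union_sdiff_of_subset (insert_subset hs (hX₀.trans ((erase_subset _ _).trans (erase_subset _ _))))]
      have hysum : ∑ i ∈ insert s X₀, y i + ∑ i ∈ insert t (W₀ \ X₀), y i = 0 := by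
        rw [← sum_union hdisj, hunion, hyT]
      have hzsum : ∑ i ∈ insert s X₀, z i + ∑ i ∈ insert t (W₀ \ X₀), z i = ∑ i ∈ T, z i := by
        rw [← sum_union hdisj, hunion]
      rw [pair_term_even a y z hrec hysum (mem_insert_self s X₀) (mem_insert_self t _), hzsum]
    rw [sum_congr rfl hX, ← mul_sum]
    congr 1
    have hsW : s ∉ W₀ := fun h => by rw [hW₀, erase_right_comm] at h; exact notMem_erase s _ h
    have htW : t ∉ W₀ := fun h => by rw [hW₀] at h; exact notMem_erase t _ h
    have hpin := treeDet_add_treeDet_eq_sum_pinned a y hsW htW hst (fun i _ j _ hij => hrec i j hij)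
      (by rw [(pair_sdiff_bookkeeping hs ht hst (subset_refl W₀)).2.2.2]; exact hyT)
    rw [(pair_sdiff_bookkeeping hs ht hst (subset_refl W₀)).2.2.2] at hpin
    exact hpin.symm
  -- regroup the four sums and conclude in characteristic two
  have e : ∀ A₁ A₂ B₁ B₂ c : ZMod 2, A₁ + B₂ = c → A₂ + B₁ = c → A₁ + A₂ + (B₂ + B₁) = 0 := by decide
  refine e _ _ _ _ _ hA hB

include hrec in
/-- **(c5) the core term of row (iv) vanishes after symmetrisation**: with `G = f_o ⋆ F` (supported on odd sets) and `Σ_D y = 1`, the blocks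
seen by `V_{st} = (p_z p_{e_t} q_{e_s}) ⋆ Y + q_{e_s} ⋆ (p_{e_t} f_o)` are even, where `core_symm_eq_zero` applies.
[cite: Chaiken1982, §2] [cite: Smith2016CongruentDensity, §2.2 case 5(b)] -/
theorem cancel_c5 {D : Finset V} (hyD : ∑ i ∈ D, y i = 1) (s t : V) :
    sconv (sconv (spoint z (spoint (Pi.single t 1) (qwt a (Pi.single s 1)))) (setExp (qwt a y)) +
          sconv (qwt a (Pi.single s 1)) (spoint (Pi.single t 1) (fwt a y z 0)))
        (sconv (fwt a y z 0) (setExp (fwt a y z z))) D +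
      sconv (sconv (spoint z (spoint (Pi.single s 1) (qwt a (Pi.single t 1)))) (setExp (qwt a y)) +
          sconv (qwt a (Pi.single t 1)) (spoint (Pi.single s 1) (fwt a y z 0)))
        (sconv (fwt a y z 0) (setExp (fwt a y z z))) D = 0 := by
  rw [← Pi.add_apply (sconv _ _) (sconv _ _) D, ← sconv_add_left]
  refine sconv_eq_zero_of fun A hA => ?_
  by_cases hG : sconv (fwt a y z 0) (setExp (fwt a y z z)) (D \ A) = 0
  · rw [hG, mul_zero]
  have hpar := sconv_support_parity y (fwt_zero_root_support_odd a y z) (setExp_fwt_self_support_even a y z hrec) _ hG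
  have hsplit : ∑ i ∈ D, y i = ∑ i ∈ A, y i + ∑ i ∈ D \ A, y i := by
    rw [← sum_union disjoint_sdiff, union_sdiff_of_subset hA]
  rw [hyD, hpar] at hsplit
  have hA0 : ∑ i ∈ A, y i = 0 := by
    have e : ∀ u : ZMod 2, 1 = u + (1 + 0) → u = 0 := by decide
    exact e _ hsplit
  rw [Pi.add_apply, core_symm_eq_zero a y z hrec hA0 s t, zero_mul]

/-! ## §5. Row (iv) -/

include hrec in
/-- **ROW (iv) OF THE EVEN Ω-IDENTITY, ABSTRACT FORM** (value at a pair of unit vectors `x = e_s`, `x′ = e_t`; `Σ_D y = 1`):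
`Β_ev(x,x′) + Β_ev(x′,x) + Β_od(x,x′) + Β_od(x′,x) = Tgt(x,x′) + Tgt(x′,x)` with
`Β_ev(x,x′) = ((p_y p_{x′}((p_x q_z) ⋆ setExp(q_{y+z}))) ⋆ setExp(fwt a y z 0))(D)`,
`Β_od(x,x′) = ((p_z p_{x′}(q_x ⋆ setExp(q_y))) ⋆ (fwt a y z 0 ⋆ setExp(fwt a y z z)))(D)`,
`Tgt(x,x′) = (Σ_D x′)·((p_y q_x) ⋆ setExp(fwt a y z z))(D)`.
For Monsky's data this is the `x_a x_b`-coefficient (`a = s ≠ b = t`) of `evenSquareFormMatrix p = evenOmegaFormMatrix p`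
(`Lines/offtyz_v7_EvenOmegaProof.md` §1, §5). [cite: Chaiken1982, §2] [cite: Stanley1999EC2, Cor. 5.1.6]
[cite: Smith2016CongruentDensity, §2.2 case 5(b)] [cite: HeathBrown1994SelmerCongruentII, Appendix (Monsky), typescript p. 41 L20–L36] -/
theorem row_four_identity {D : Finset V} (hyD : ∑ i ∈ D, y i = 1) (s t : V) :
    sconv (spoint y (spoint (Pi.single t 1) (sconv (spoint (Pi.single s 1) (qwt a z)) (setExp (qwt a (fun i => y i + z i))))))
        (setExp (fwt a y z 0)) D +
      sconv (spoint y (spoint (Pi.single s 1) (sconv (spoint (Pi.single t 1) (qwt a z)) (setExp (qwt a (fun i => y i + z i))))))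
        (setExp (fwt a y z 0)) D +
      sconv (spoint z (spoint (Pi.single t 1) (sconv (qwt a (Pi.single s 1)) (setExp (qwt a y)))))
        (sconv (fwt a y z 0) (setExp (fwt a y z z))) D +
      sconv (spoint z (spoint (Pi.single s 1) (sconv (qwt a (Pi.single t 1)) (setExp (qwt a y)))))
        (sconv (fwt a y z 0) (setExp (fwt a y z z))) D =
      (∑ i ∈ D, (Pi.single t (1 : ZMod 2) : V → ZMod 2) i) * sconv (spoint y (qwt a (Pi.single s 1))) (setExp (fwt a y z z)) D +
      (∑ i ∈ D, (Pi.single s (1 : ZMod 2) : V → ZMod 2) i) * sconv (spoint y (qwt a (Pi.single t 1))) (setExp (fwt a y z z)) D := by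
  -- the target as a pointed convolution
  have hT : ∀ u v : V → ZMod 2, (∑ i ∈ D, v i) * sconv (spoint y (qwt a u)) (setExp (fwt a y z z)) D =
      (sconv (spoint v (spoint y (qwt a u))) (setExp (fwt a y z z)) +
        sconv (spoint y (qwt a u)) (sconv (spoint v (fwt a y z z)) (setExp (fwt a y z z)))) D := by
    intro u v
    rw [← spoint_apply v (sconv (spoint y (qwt a u)) (setExp (fwt a y z z))) D, spoint_sconv, spoint_setExp]
  have hY : ∀ v : V → ZMod 2, spoint v (setExp (qwt a y)) = spoint y (qwt a v) := spoint_setExp_qwt_eq a y hrec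
  rw [hT, hT, bev_expand a y z hrec, bev_expand a y z hrec, bod_expand a y z hrec, bod_expand a y z hrec]
  simp only [hY, sconv_add_left, Pi.add_apply]
  -- the cancellations (`x = e_s`, `x' = e_t`)
  have c1 := congrFun (cancel_c1 a y z (Pi.single s 1) (Pi.single t 1)) D
  have c1' := congrFun (cancel_c1 a y z (Pi.single t 1) (Pi.single s 1)) D
  have c2 := congrFun (cancel_c2 a y z hrec (Pi.single s 1) (Pi.single t 1)) D
  have c3 := cancel_c3 a y z (Pi.single s 1) (Pi.single t 1) D
  have c4 := cancel_c4 a y z hrec hyD (Pi.single s 1) (Pi.single t 1)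
  have c4' := cancel_c4 a y z hrec hyD (Pi.single t 1) (Pi.single s 1)
  have c5 := cancel_c5 a y z hrec hyD s t
  simp only [Pi.add_apply] at c1 c1' c3
  simp only [sconv_add_left, Pi.add_apply] at c5
  -- the formally symmetric terms
  have s1 : spoint y (spoint (Pi.single t (1 : ZMod 2)) (spoint (Pi.single s (1 : ZMod 2)) (qwt a z))) =
      spoint y (spoint (Pi.single s 1) (spoint (Pi.single t 1) (qwt a z))) := by rw [spoint_comm (Pi.single t 1) (Pi.single s 1)]
  have s2 : spoint (Pi.single t (1 : ZMod 2)) (spoint (Pi.single s (1 : ZMod 2)) (qwt a z)) =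
      spoint (Pi.single s 1) (spoint (Pi.single t 1) (qwt a z)) := spoint_comm _ _ _
  have s8 := congrFun (sconv_swap_outer (spoint (Pi.single s (1 : ZMod 2)) (qwt a z)) (spoint (Pi.single t (1 : ZMod 2)) (qwt a z))
    (setExp (qwt a y)) (setExp (fwt a y z z))) D
  have s9 := congrFun (sconv_left_comm (spoint (Pi.single s (1 : ZMod 2)) (qwt a z)) (spoint (Pi.single t (1 : ZMod 2)) (qwt a z))
    (setExp (fwt a y z z))) D
  have s12 := congrFun (sconv_swap_outer (spoint (Pi.single s (1 : ZMod 2)) (qwt a z)) (spoint (Pi.single t (1 : ZMod 2)) (qwt a z))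
    (setExp (qwt a y)) (sconv (fwt a y z 0) (setExp (fwt a y z z)))) D
  rw [s1, s2]
  grind

end RowFour

end Summit.BirchSwinnertonDyer.PrintCf2.QFormForest
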